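import Mathlib.FieldTheory.IsAlgClosed.Basic
import Mathlib.Analysis.Complex.Polynomial.Basic
import Mathlib.RingTheory.MvPolynomial.Homogeneous
import Literature.Combinatorics.StablePolynomials.Limits
import HarnessLib

/-!
# The same-phase theorem for homogeneous stable polynomials (Choe–Oxley–Sokal–Wagner, Thm. 6.1)

Y.-B. Choe, J. G. Oxley, A. D. Sokal, D. G. Wagner, *Homogeneous multivariate polynomials with the half-plane
property*, Adv. Appl. Math. 32 (2004) 88–187 (arXiv:math/0202034), §6:

> Let us say that a pair of nonzero complex numbers `a, b` have the same phase if `a/b ∈ (0, ∞)` […] a collection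
> `{a_α}` of nonzero complex numbers all have the same phase if and only if there exists `θ ∈ ℝ` such that
> `e^{-iθ} a_α > 0` for all `α`. […] **Theorem 6.1.** Let `P(x) = Σ_m a_m x^m` be a polynomial in `n` complex
> variables that is homogeneous of degree `r`. If `P` has the half-plane property, then all the nonzero
> coefficients `a_m` have the same phase.

COSW's half-plane property refers to the open right half-plane; for a homogeneous `P` it is equivalent to upper
half-plane stability (`P(iz) = i^r P(z)`), which is the tree's `IsUpperHalfPlaneStable`, and the statement is
unchanged (a global phase `i^r`). The proof below is the printed one: induction on the number of variables via
the coefficients `P_k` of `P = Σ_k x_n^k P_k(x_1, …, x_{n-1})` (each `P_k` is homogeneous and has the half-plane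
property or vanishes, Cor. 2.10 — here from `∂/∂x_n` (Gauss–Lucas, tree `IsUpperHalfPlaneStable.pderiv_none`) and
the real specialisation `x_n := 0` (tree `IsUpperHalfPlaneStable.specialize_real`)), the phases of the `P_k`
being tied together by the univariate polynomial `p(ζ) = P(1, …, 1, ζ) = Σ_k P_k(1, …, 1) ζ^k`, whose zeros are
real and nonpositive (Prop. 5.2 (a) ⇒ (b)) so that its coefficients `a Π e_j(c)`, `c_j ≥ 0`, share a phase.

## Main results (namespace `Literature.Combinatorics.StablePolynomials`)

* `HasSamePhase p` — "all the nonzero coefficients of `p` have the same phase": some unit `u` makes every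
  `u · a_m` a nonnegative real.
* `exists_unit_mul_coeff_nonneg_of_roots_nonpos` — a univariate complex polynomial whose zeros are real and
  nonpositive has coefficients of one phase.
* `IsUpperHalfPlaneStable.optionEquivLeft_coeff` — **Cor. 2.10** in one variable: the coefficients `P_k` of a stable
  `P` in a distinguished variable are `0` or stable.
* `IsUpperHalfPlaneStable.im_eq_zero_and_re_nonpos_of_eval_eq_zero` — **Prop. 5.2 (a) ⇒ (b)** for the pair
  `x = e_n`, `y = 𝟙 - e_n`: the zeros of `ζ ↦ P(1, …, 1, ζ)` are real nonpositive.
* `IsUpperHalfPlaneStable.hasSamePhase` — **Theorem 6.1**.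
* `IsRealStable.coeff_nonneg_or_nonpos` — real form: a homogeneous real stable polynomial has all its coefficients
  `≥ 0` or all `≤ 0`.

## References

* Y.-B. Choe, J. G. Oxley, A. D. Sokal, D. G. Wagner, *Homogeneous multivariate polynomials with the half-plane
  property*, Adv. Appl. Math. 32 (2004), 88–187; arXiv:math/0202034, §2.4 Cor. 2.10, §5.1 Prop. 5.2, §6 Thm. 6.1.
  [ChoeOxleySokalWagner2004]
* D. G. Wagner, *Multivariate stable polynomials: theory and applications*, Bull. AMS 48 (2011), Lemma 2.4.
  [Wagner2011]
-/

noncomputable section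

open MvPolynomial Finset
open scoped Polynomial ComplexConjugate

namespace Literature.Combinatorics.StablePolynomials

/-! ## §1 The same-phase property -/

section SamePhase

variable {σ : Type*}

/-- **Same-phase property** (COSW §6: "a collection `{a_α}` of nonzero complex numbers all have the same phase if
and only if there exists `θ ∈ ℝ` such that `e^{-iθ} a_α > 0` for all `α`"; "`P` has the same-phase property if all
the nonzero coefficients `a_m` have the same phase"): there is a unit `u = e^{-iθ}` such that every `u a_m` is a
nonnegative real. [cite: ChoeOxleySokalWagner2004, §6 (definition of the same-phase property)] -/
def HasSamePhase (p : MvPolynomial σ ℂ) : Prop :=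
  ∃ u : ℂ, ‖u‖ = 1 ∧ ∀ m, (u * coeff m p).im = 0 ∧ 0 ≤ (u * coeff m p).re

/-- Unfolding. [cite: ChoeOxleySokalWagner2004, §6] -/
theorem hasSamePhase_iff (p : MvPolynomial σ ℂ) :
    HasSamePhase p ↔ ∃ u : ℂ, ‖u‖ = 1 ∧ ∀ m, (u * coeff m p).im = 0 ∧ 0 ≤ (u * coeff m p).re := Iff.rfl

/-- The zero polynomial has the same-phase property (vacuously). [cite: ChoeOxleySokalWagner2004, §6] -/
theorem hasSamePhase_zero : HasSamePhase (0 : MvPolynomial σ ℂ) :=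
  ⟨1, by simp, fun m => by simp⟩

/-- The unit `ū/|u|` turns `u ≠ 0` into the positive real `|u|`. [folklore] -/
private theorem conj_div_norm_mul_self {a : ℂ} (ha : a ≠ 0) :
    conj a / (‖a‖ : ℂ) * a = (‖a‖ : ℂ) := by
  have hn : (‖a‖ : ℂ) ≠ 0 := Complex.ofReal_ne_zero.2 (norm_ne_zero_iff.2 ha)
  rw [div_mul_eq_mul_div, Complex.conj_mul', div_eq_iff hn, sq]

/-- `‖ū/|u|‖ = 1`. [folklore] -/
private theorem norm_conj_div_norm {a : ℂ} (ha : a ≠ 0) : ‖conj a / (‖a‖ : ℂ)‖ = 1 := by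
  rw [norm_div, Complex.norm_conj, Complex.norm_real, Real.norm_eq_abs, abs_norm,
    div_self (norm_ne_zero_iff.2 ha)]

/-- A constant has the same-phase property ("If `n = 1`, we must have `P(x) = a_r x^r`, so the theorem is trivial";
the case of no variables). [cite: ChoeOxleySokalWagner2004, §6 proof of Thm. 6.1] -/
theorem hasSamePhase_C (a : ℂ) : HasSamePhase (C a : MvPolynomial σ ℂ) := by
  classical
  by_cases ha : a = 0
  · rw [ha, C_0]
    exact hasSamePhase_zero
  refine ⟨conj a / (‖a‖ : ℂ), norm_conj_div_norm ha, fun m => ?_⟩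
  rw [coeff_C]
  split_ifs
  · rw [conj_div_norm_mul_self ha, Complex.ofReal_im, Complex.ofReal_re]
    exact ⟨rfl, norm_nonneg a⟩
  · simp

/-- The same-phase property is invariant under renaming the variables along an equivalence.
[cite: ChoeOxleySokalWagner2004, §6] -/
theorem hasSamePhase_of_rename_equiv {τ : Type*} (e : σ ≃ τ) {p : MvPolynomial σ ℂ}
    (h : HasSamePhase (rename e p)) : HasSamePhase p := by
  obtain ⟨u, hu, h⟩ := h
  refine ⟨u, hu, fun m => ?_⟩
  have := h (m.mapDomain e)
  rwa [coeff_rename_mapDomain _ e.injective] at this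

end SamePhase

/-! ## §2 Univariate polynomials with real nonpositive zeros have coefficients of one phase -/

section Univariate

/-- The coefficients of `Π_j (X - ρ_j)` with all `ρ_j` real and `≤ 0` are nonnegative reals ("it can be written as
`a Π_{k=1}^M (ζ + c_k)` for […] nonnegative real numbers `c_1, …, c_M`; so its coefficients […] must all have the
same phase"). [cite: ChoeOxleySokalWagner2004, §6 proof of Thm. 6.1] -/
private theorem coeff_prod_X_sub_C_nonneg (s : Multiset ℂ) (hs : ∀ ρ ∈ s, ρ.im = 0 ∧ ρ.re ≤ 0) (k : ℕ) :
    ((s.map fun ρ => Polynomial.X - Polynomial.C ρ).prod.coeff k).im = 0 ∧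
      0 ≤ ((s.map fun ρ => Polynomial.X - Polynomial.C ρ).prod.coeff k).re := by
  induction s using Multiset.induction_on generalizing k with
  | empty =>
    simp only [Multiset.map_zero, Multiset.prod_zero, Polynomial.coeff_one]
    split_ifs <;> simp
  | cons ρ s ih =>
    have hρ := hs ρ (Multiset.mem_cons_self ρ s)
    have hs' : ∀ x ∈ s, x.im = 0 ∧ x.re ≤ 0 := fun x hx => hs x (Multiset.mem_cons_of_mem hx)
    rw [Multiset.map_cons, Multiset.prod_cons, sub_mul, Polynomial.coeff_sub, Polynomial.coeff_C_mul]
    cases k with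
    | zero =>
      rw [Polynomial.coeff_X_mul_zero, zero_sub, Complex.neg_im, Complex.neg_re, Complex.mul_im,
        Complex.mul_re, hρ.1, (ih hs' 0).1]
      refine ⟨by ring, ?_⟩
      nlinarith [hρ.2, (ih hs' 0).2]
    | succ k =>
      rw [Polynomial.coeff_X_mul, Complex.sub_im, Complex.sub_re, Complex.mul_im, Complex.mul_re, hρ.1,
        (ih hs' (k + 1)).1, (ih hs' k).1]
      refine ⟨by ring, ?_⟩
      nlinarith [hρ.2, (ih hs' (k + 1)).2, (ih hs' k).2]

/-- **A complex polynomial all of whose zeros are real and nonpositive has coefficients of one phase**: there is a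
unit `u` with `u · [ζ^k] q ∈ [0, ∞)` for all `k` (COSW: "`p_{x,y}` has only real nonpositive zeros, [so] it can be
written as `a Π (ζ + c_k)` […]; so its coefficients must all have the same phase").
[cite: ChoeOxleySokalWagner2004, §6 proof of Thm. 6.1] -/
theorem exists_unit_mul_coeff_nonneg_of_roots_nonpos {q : ℂ[X]} (hq : q ≠ 0)
    (hroots : ∀ ζ, q.IsRoot ζ → ζ.im = 0 ∧ ζ.re ≤ 0) :
    ∃ u : ℂ, ‖u‖ = 1 ∧ ∀ k, (u * q.coeff k).im = 0 ∧ 0 ≤ (u * q.coeff k).re := by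
  have hlead : q.leadingCoeff ≠ 0 := Polynomial.leadingCoeff_ne_zero.2 hq
  have hsplit := Polynomial.C_leadingCoeff_mul_prod_multiset_X_sub_C
    (IsAlgClosed.card_roots_eq_natDegree (p := q))
  have hs : ∀ ρ ∈ q.roots, ρ.im = 0 ∧ ρ.re ≤ 0 := fun ρ hρ =>
    hroots ρ ((Polynomial.mem_roots hq).1 hρ)
  refine ⟨conj q.leadingCoeff / (‖q.leadingCoeff‖ : ℂ), norm_conj_div_norm hlead, fun k => ?_⟩
  have hcoeff : q.coeff k =
      q.leadingCoeff * ((q.roots.map fun a => Polynomial.X - Polynomial.C a).prod).coeff k := by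
    nth_rewrite 1 [← hsplit]
    rw [Polynomial.coeff_C_mul]
  rw [hcoeff, ← mul_assoc, conj_div_norm_mul_self hlead]
  obtain ⟨him, hre⟩ := coeff_prod_X_sub_C_nonneg q.roots hs k
  constructor
  · rw [Complex.mul_im, Complex.ofReal_im, Complex.ofReal_re, him, zero_mul, mul_zero, add_zero]
  · rw [Complex.mul_re, Complex.ofReal_im, Complex.ofReal_re, him, mul_zero, sub_zero]
    exact mul_nonneg (norm_nonneg _) hre

end Univariate

/-! ## §3 One distinguished variable: the coefficients `P_k` and the zeros of `ζ ↦ P(𝟙, ζ)` -/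

section OptionVar

variable {τ : Type*} [Fintype τ]

omit [Fintype τ] in
/-- `optionEquivLeft` turns `(∂/∂x_{none})^k` into the `k`-th derivative. [folklore] -/
private theorem optionEquivLeft_iterate_pderiv_none (p : MvPolynomial (Option τ) ℂ) (k : ℕ) :
    optionEquivLeft ℂ τ ((pderiv none)^[k] p) = (Polynomial.derivative)^[k] (optionEquivLeft ℂ τ p) := by
  induction k with
  | zero => rfl
  | succ k ih => rw [Function.iterate_succ_apply', Function.iterate_succ_apply', optionEquivLeft_pderiv_none, ih]

/-- Iterated `∂/∂x_{none}` preserves "stable or zero". [cite: Wagner2011, Lemma 2.4 (f)]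
[cite: ChoeOxleySokalWagner2004, §2.4 Cor. 2.9] -/
private theorem isUpperHalfPlaneStable_iterate_pderiv_none {p : MvPolynomial (Option τ) ℂ}
    (hp : IsUpperHalfPlaneStable p) (k : ℕ) :
    (pderiv none)^[k] p = 0 ∨ IsUpperHalfPlaneStable ((pderiv none)^[k] p) := by
  induction k with
  | zero => exact Or.inr hp
  | succ k ih =>
    rw [Function.iterate_succ_apply']
    rcases ih with h | h
    · left
      rw [h, map_zero]
    · exact h.pderiv_none

omit [Fintype τ] in
/-- **Evaluation of `(∂/∂x_n)^k P` at `x_n = 0` is `k! · P_k`** ("`P_k(x') = (1/k!) (∂/∂x_n)^k P(x) |_{x_n = 0}`").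
[cite: ChoeOxleySokalWagner2004, §6 proof of Thm. 6.1 and §2.4 Cor. 2.10] -/
theorem eval_iterate_pderiv_none_zero (p : MvPolynomial (Option τ) ℂ) (k : ℕ) (z' : τ → ℂ) :
    eval (fun o => Option.elim o 0 z') ((pderiv none)^[k] p) =
      (k.factorial : ℂ) * eval z' ((optionEquivLeft ℂ τ p).coeff k) := by
  rw [optionEquivLeft_elim_eval, ← Polynomial.coeff_zero_eq_eval_zero, Polynomial.coeff_map,
    optionEquivLeft_iterate_pderiv_none, Polynomial.coeff_iterate_derivative, zero_add, Nat.descFactorial_self,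
    map_nsmul, nsmul_eq_mul]

/-- **COSW Corollary 2.10 (one distinguished variable)**: if `P = Σ_k x_n^k P_k(x')` has the half-plane property
then every coefficient polynomial `P_k` has the half-plane property or vanishes. Proof as printed:
`P_k = (1/k!) ∂^k_{x_n} P |_{x_n = 0}` with Cor. 2.9 (derivatives; tree `IsUpperHalfPlaneStable.pderiv_none`) and
the real specialisation `x_n := 0` (tree `IsUpperHalfPlaneStable.specialize_real`).
[cite: ChoeOxleySokalWagner2004, §2.4 Cor. 2.10] -/
theorem IsUpperHalfPlaneStable.optionEquivLeft_coeff {p : MvPolynomial (Option τ) ℂ}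
    (hp : IsUpperHalfPlaneStable p) (k : ℕ) :
    (optionEquivLeft ℂ τ p).coeff k = 0 ∨ IsUpperHalfPlaneStable ((optionEquivLeft ℂ τ p).coeff k) := by
  classical
  set Pk := (optionEquivLeft ℂ τ p).coeff k with hPk
  by_cases hzero : ∀ z' : τ → ℂ, (∀ j, 0 < (z' j).im) → eval z' Pk = 0
  · left
    by_contra hne
    obtain ⟨z', hz', h⟩ := exists_eval_ne_zero hne
    exact h (hzero z' hz')
  push Not at hzero
  obtain ⟨z₀, hz₀, hz₀ne⟩ := hzero
  right
  have hk0 : (k.factorial : ℂ) ≠ 0 := Nat.cast_ne_zero.2 (Nat.factorial_ne_zero k)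
  -- `D = ∂^k P` is stable (it is not zero: its value at `(z₀, 0)` is `k! P_k(z₀) ≠ 0`)
  have hDst : IsUpperHalfPlaneStable ((MvPolynomial.pderiv none)^[k] p) := by
    refine (isUpperHalfPlaneStable_iterate_pderiv_none hp k).resolve_left fun h => hz₀ne ?_
    have h1 := eval_iterate_pderiv_none_zero p k z₀
    rw [h, map_zero] at h1
    exact (mul_eq_zero.1 h1.symm).resolve_left hk0
  -- its specialisation `x_n := 0` is stable (again not zero), and equals `k! P_k`
  have hSval : ∀ z' : τ → ℂ, eval (fun o => Option.elim o Complex.I z')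
      (bind₁ (Function.update X none (C (0 : ℂ))) ((MvPolynomial.pderiv none)^[k] p)) =
      (k.factorial : ℂ) * eval z' Pk := by
    intro z'
    have hupd : Function.update (fun o => Option.elim o Complex.I z') none 0 = fun o => Option.elim o 0 z' := by
      funext o
      cases o with
      | none => simp
      | some j => simp
    rw [eval_bind₁_update, hupd, eval_iterate_pderiv_none_zero]
  have hS := hDst.specialize_real none (0 : ℝ)
  rw [Complex.ofReal_zero] at hS
  rcases hS with h | h
  · exfalso
    refine hz₀ne ((mul_eq_zero.1 ?_).resolve_left hk0)
    rw [← hSval z₀, h, map_zero]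
  · intro z' hz' h0
    refine h (fun o => Option.elim o Complex.I z') (fun o => ?_) ?_
    · cases o with
      | none => simp
      | some j => simpa using hz' j
    · rw [hSval, h0, mul_zero]

omit [Fintype τ] in
/-- The degree of the exponent `(d, k)` is `k + |d|`. [folklore] -/
private theorem degree_optionElim (k : ℕ) (d : τ →₀ ℕ) : (d.optionElim k).degree = k + d.degree := by
  classical
  have h := Finsupp.sum_option_index (d.optionElim k) (fun _ e => e) (fun _ => rfl) fun _ _ _ => rfl
  simp only [Finsupp.optionElim_apply_none, Finsupp.some_optionElim] at h
  exact h

/-- **The coefficients `P_k` of a homogeneous `P` of degree `r` are homogeneous of degree `r - k`** ("each `P_k`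
is a homogeneous polynomial (of degree `r - k`) in `n - 1` variables"; for `k > r`, `P_k = 0`).
[cite: ChoeOxleySokalWagner2004, §6 proof of Thm. 6.1] -/
theorem isHomogeneous_optionEquivLeft_coeff {p : MvPolynomial (Option τ) ℂ} {r : ℕ} (hp : p.IsHomogeneous r)
    (k : ℕ) : ((optionEquivLeft ℂ τ p).coeff k).IsHomogeneous (r - k) := by
  by_cases hk : k ≤ r
  · have hp' : ((optionEquivLeft ℂ τ).symm (optionEquivLeft ℂ τ p)).IsHomogeneous r := by
      rwa [AlgEquiv.symm_apply_apply]
    exact hp'.coeff_isHomogeneous_of_optionEquivLeft_symm k (r - k) (by omega)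
  · have h0 : (optionEquivLeft ℂ τ p).coeff k = 0 := by
      ext d
      rw [optionEquivLeft_coeff_coeff, coeff_zero]
      exact hp.coeff_eq_zero (by rw [degree_optionElim]; omega)
    rw [h0]
    exact isHomogeneous_zero _ _ _

/-- `F(c • v) = c^r F(v)` for a form of degree `r`. [folklore] -/
private theorem eval_smul_eq_pow_mul' {ι : Type*} {F : MvPolynomial ι ℂ} {r : ℕ} (hF : F.IsHomogeneous r)
    (c : ℂ) (v : ι → ℂ) : eval (c • v) F = c ^ r * eval v F := by
  rw [eval_eq, eval_eq, Finset.mul_sum]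
  refine Finset.sum_congr rfl fun m hm => ?_
  simp only [Pi.smul_apply, smul_eq_mul, mul_pow, Finset.prod_mul_distrib, Finset.prod_pow_eq_pow_sum,
    ← hF.degree_eq_sum_deg_support hm]
  ring

omit [Fintype τ] in
/-- **COSW Proposition 5.2, (a) ⇒ (b), for `x = e_n`, `y = (1, …, 1, 0)`** ("If `ζ₀ ∈ ℂ ∖ (-∞, 0]`, then we can find
`α, β ∈ H` such that `α/β = ζ₀`. But this means that `p_{x,y}(α/β) = β^{-r} P(αx + βy) ≠ 0`"): for a stable form
`P`, every zero of `ζ ↦ P(1, …, 1, ζ)` is real and nonpositive. Here `β = i(|ζ| + ζ̄)` and `α = βζ` lie in the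
upper half-plane exactly when `ζ ∉ (-∞, 0]`. [cite: ChoeOxleySokalWagner2004, §5.1 Prop. 5.2 and §6 proof of
Thm. 6.1] -/
theorem IsUpperHalfPlaneStable.im_eq_zero_and_re_nonpos_of_eval_eq_zero {p : MvPolynomial (Option τ) ℂ}
    (hp : IsUpperHalfPlaneStable p) {r : ℕ} (hhom : p.IsHomogeneous r) {ζ : ℂ}
    (h0 : eval (fun o => Option.elim o ζ fun _ => (1 : ℂ)) p = 0) : ζ.im = 0 ∧ ζ.re ≤ 0 := by
  by_contra hcon
  -- `ζ ∉ (-∞, 0]` means `Re ζ + |ζ| > 0`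
  have hkey : 0 < ζ.re + ‖ζ‖ := by
    by_cases him : ζ.im = 0
    · have hre : 0 < ζ.re := by
        by_contra hre
        exact hcon ⟨him, not_lt.1 hre⟩
      linarith [norm_nonneg ζ]
    · have h := Complex.abs_re_lt_norm.2 him
      linarith [neg_abs_le ζ.re]
  have hζ0 : ζ ≠ 0 := by
    rintro rfl
    exact hcon ⟨rfl, le_rfl⟩
  -- the multiplier `β = i(|ζ| + ζ̄)`
  set β : ℂ := Complex.I * ((‖ζ‖ : ℂ) + conj ζ) with hβ
  have hβim : β.im = ‖ζ‖ + ζ.re := by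
    simp [hβ, Complex.mul_im]
  have hβζ : β * ζ = Complex.I * ((‖ζ‖ : ℂ) * ζ + (‖ζ‖ : ℂ) ^ 2) := by
    rw [hβ, mul_assoc, add_mul, Complex.conj_mul']
  have hβζim : (β * ζ).im = ‖ζ‖ * (ζ.re + ‖ζ‖) := by
    rw [hβζ]
    simp [Complex.mul_im, sq]
    ring
  have hpt : ∀ o, 0 < ((β • fun o : Option τ => Option.elim o ζ fun _ => (1 : ℂ)) o).im := by
    intro o
    cases o with
    | none =>
      simp only [Pi.smul_apply, Option.elim_none, smul_eq_mul, hβζim]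
      exact mul_pos (norm_pos_iff.2 hζ0) hkey
    | some j =>
      simp only [Pi.smul_apply, Option.elim_some, smul_eq_mul, mul_one, hβim]
      linarith
  refine hp _ hpt ?_
  rw [eval_smul_eq_pow_mul' hhom, h0, mul_zero]

end OptionVar

/-! ## §4 Theorem 6.1 -/

section Main

/-- The value at `𝟙 = (1, …, 1)` of a polynomial with the same-phase property is nonzero unless the polynomial is,
and it has the phase of the coefficients: `u · p(𝟙) = Σ_m u a_m > 0`. [cite: ChoeOxleySokalWagner2004, §6 proof
of Thm. 6.1] -/
private theorem samePhase_eval_one {σ : Type*} {p : MvPolynomial σ ℂ} {u : ℂ} (hu0 : u ≠ 0)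
    (hu : ∀ m, (u * coeff m p).im = 0 ∧ 0 ≤ (u * coeff m p).re) (hp : p ≠ 0) :
    (u * eval (fun _ => (1 : ℂ)) p).im = 0 ∧ 0 < (u * eval (fun _ => (1 : ℂ)) p).re := by
  have hev : eval (fun _ => (1 : ℂ)) p = ∑ m ∈ p.support, coeff m p := by
    rw [eval_eq]
    exact Finset.sum_congr rfl fun m _ => by simp
  rw [hev, Finset.mul_sum, Complex.im_sum, Complex.re_sum]
  refine ⟨Finset.sum_eq_zero fun m _ => (hu m).1, ?_⟩
  obtain ⟨m, hm⟩ : p.support.Nonempty := Finset.nonempty_of_ne_empty fun h => hp (support_eq_empty.1 h)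
  refine Finset.sum_pos' (fun m _ => (hu m).2) ⟨m, hm, ?_⟩
  -- `u a_m ≠ 0` is a nonnegative real, hence positive
  have hne : u * coeff m p ≠ 0 := mul_ne_zero hu0 (mem_support_iff.1 hm)
  refine (hu m).2.lt_of_ne fun h => hne (Complex.ext ?_ ?_)
  · rw [Complex.zero_re, ← h]
  · rw [Complex.zero_im, (hu m).1]

/-- **The induction step of Theorem 6.1** ("each `P_k` is a homogeneous polynomial of degree `r - k` in `n - 1`
variables; and by Corollary 2.10 it has the half-plane property. So, by the inductive hypothesis, all its nonzero
coefficients have the same phase. […] we need only show that these phases are the same for all `k`":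
`p(ζ) = P(1, …, 1, ζ) = Σ_k P_k(1, …, 1) ζ^k` has only real nonpositive zeros, so its coefficients `P_k(𝟙)` have a
common phase, and `P_k(𝟙)` has the phase of `P_k`). [cite: ChoeOxleySokalWagner2004, §6 proof of Thm. 6.1] -/
private theorem hasSamePhase_step {τ : Type*} [Fintype τ]
    (ih : ∀ (q : MvPolynomial τ ℂ) (r : ℕ), q.IsHomogeneous r → IsUpperHalfPlaneStable q → HasSamePhase q)
    {p : MvPolynomial (Option τ) ℂ} {r : ℕ} (hhom : p.IsHomogeneous r) (hp : IsUpperHalfPlaneStable p) :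
    HasSamePhase p := by
  classical
  -- phases of the coefficient polynomials `P_k`
  have hPk : ∀ k, ∃ u : ℂ, ‖u‖ = 1 ∧ ∀ m, (u * coeff m ((optionEquivLeft ℂ τ p).coeff k)).im = 0 ∧
      0 ≤ (u * coeff m ((optionEquivLeft ℂ τ p).coeff k)).re := by
    intro k
    rcases hp.optionEquivLeft_coeff k with h0 | hst
    · rw [h0]
      exact hasSamePhase_zero
    · exact ih _ _ (isHomogeneous_optionEquivLeft_coeff hhom k) hst
  choose u hu1 hu using hPk
  have hu0 : ∀ k, u k ≠ 0 := fun k => norm_ne_zero_iff.1 (by rw [hu1 k]; exact one_ne_zero)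
  -- the univariate polynomial `q(ζ) = P(𝟙, ζ)`
  set q : ℂ[X] := (optionEquivLeft ℂ τ p).map (eval fun _ => (1 : ℂ)) with hq
  have hqcoeff : ∀ k, q.coeff k = eval (fun _ => (1 : ℂ)) ((optionEquivLeft ℂ τ p).coeff k) := fun k => by
    rw [hq, Polynomial.coeff_map]
  have hqeval : ∀ ζ, q.eval ζ = eval (fun o => Option.elim o ζ fun _ => (1 : ℂ)) p := fun ζ => by
    rw [hq, ← optionEquivLeft_elim_eval]
  have hp0 : p ≠ 0 := fun h => hp (fun _ => Complex.I) (fun _ => by simp) (by rw [h, map_zero])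
  have hq0 : q ≠ 0 := by
    -- some `P_k ≠ 0` (else `p = 0`), and then `[ζ^k] q = P_k(𝟙) ≠ 0`
    obtain ⟨k, hk⟩ : ∃ k, (optionEquivLeft ℂ τ p).coeff k ≠ 0 := by
      by_contra h
      push Not at h
      apply hp0
      have hP : optionEquivLeft ℂ τ p = 0 := Polynomial.ext fun k => by rw [h k, Polynomial.coeff_zero]
      exact (optionEquivLeft ℂ τ).injective (hP.trans (map_zero _).symm)
    intro hq0
    have h1 := samePhase_eval_one (hu0 k) (hu k) hk
    rw [← hqcoeff, hq0, Polynomial.coeff_zero, mul_zero, Complex.zero_re] at h1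
    exact lt_irrefl _ h1.2
  have hroots : ∀ ζ, q.IsRoot ζ → ζ.im = 0 ∧ ζ.re ≤ 0 := fun ζ hζ =>
    hp.im_eq_zero_and_re_nonpos_of_eval_eq_zero hhom (by rw [← hqeval]; exact hζ)
  obtain ⟨v, hv1, hv⟩ := exists_unit_mul_coeff_nonneg_of_roots_nonpos hq0 hroots
  refine ⟨v, hv1, fun m => ?_⟩
  -- the coefficient `a_m` of `p` is the coefficient of `m|_τ` in `P_{m(n)}`
  have hcoeff : coeff m p = coeff m.some ((optionEquivLeft ℂ τ p).coeff (m none)) := by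
    rw [optionEquivLeft_coeff_coeff, Finsupp.optionElim_some]
  rw [hcoeff]
  by_cases ha : coeff m.some ((optionEquivLeft ℂ τ p).coeff (m none)) = 0
  · rw [ha, mul_zero, Complex.zero_im, Complex.zero_re]
    exact ⟨rfl, le_rfl⟩
  -- `P_k ≠ 0` (`k = m(n)`) has phase `u_k`; `c = P_k(𝟙)`: `u_k c > 0`, `v c ≥ 0`, both real
  have hPk0 : (optionEquivLeft ℂ τ p).coeff (m none) ≠ 0 := fun h => ha (by rw [h, coeff_zero])
  obtain ⟨hcim, hcre⟩ := samePhase_eval_one (hu0 (m none)) (hu (m none)) hPk0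
  have hvc := hv (m none)
  rw [hqcoeff] at hvc
  set c := eval (fun _ => (1 : ℂ)) ((optionEquivLeft ℂ τ p).coeff (m none)) with hc
  have hc0 : c ≠ 0 := fun h => by
    rw [h, mul_zero, Complex.zero_re] at hcre
    exact lt_irrefl _ hcre
  -- `v = ((v c)/(u_k c)) u_k`, a nonnegative real multiple of `u_k`
  have hv_eq : v = (v * c) / (u (m none) * c) * u (m none) := by
    rw [div_mul_eq_mul_div, eq_div_iff (mul_ne_zero (hu0 _) hc0)]
    ring
  have hs : u (m none) * c = ((u (m none) * c).re : ℂ) :=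
    Complex.ext (by rw [Complex.ofReal_re]) (by rw [Complex.ofReal_im, hcim])
  have hs' : v * c = ((v * c).re : ℂ) :=
    Complex.ext (by rw [Complex.ofReal_re]) (by rw [Complex.ofReal_im, hvc.1])
  obtain ⟨htim, htre⟩ := hu (m none) m.some
  have ht : u (m none) * coeff m.some ((optionEquivLeft ℂ τ p).coeff (m none)) =
      ((u (m none) * coeff m.some ((optionEquivLeft ℂ τ p).coeff (m none))).re : ℂ) :=
    Complex.ext (by rw [Complex.ofReal_re]) (by rw [Complex.ofReal_im, htim])
  rw [hv_eq, mul_assoc, ht, hs, hs', ← Complex.ofReal_div, ← Complex.ofReal_mul, Complex.ofReal_im,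
    Complex.ofReal_re]
  exact ⟨rfl, mul_nonneg (div_nonneg hvc.2 hcre.le) htre⟩

/-- **Choe–Oxley–Sokal–Wagner, Theorem 6.1 (the same-phase theorem)**: "Let `P(x) = Σ_m a_m x^m` be a polynomial
in `n` complex variables that is homogeneous of degree `r`. If `P` has the half-plane property, then all the
nonzero coefficients `a_m` have the same phase." Proof as printed: induction on the number of variables (here
`Fintype.induction_empty_option`: transport along a relabelling, the constant case, and the step
`hasSamePhase_step`). [cite: ChoeOxleySokalWagner2004, §6 Thm. 6.1] -/
theorem IsUpperHalfPlaneStable.hasSamePhase {σ : Type*} [Fintype σ] {p : MvPolynomial σ ℂ} {r : ℕ}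
    (hhom : p.IsHomogeneous r) (hp : IsUpperHalfPlaneStable p) : HasSamePhase p := by
  have key : ∀ (p : MvPolynomial σ ℂ) (r : ℕ), p.IsHomogeneous r → IsUpperHalfPlaneStable p → HasSamePhase p := by
    refine Fintype.induction_empty_option (P := fun α _ => ∀ (p : MvPolynomial α ℂ) (r : ℕ),
      p.IsHomogeneous r → IsUpperHalfPlaneStable p → HasSamePhase p) ?_ ?_ ?_ σ
    · -- transport along an equivalence of variables
      intro α β _ e ih p r hhom hp
      exact hasSamePhase_of_rename_equiv e.symm
        (ih (MvPolynomial.rename e.symm p) r hhom.rename_isHomogeneous (hp.rename _))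
    · -- no variables: `p` is a constant
      intro p r _ _
      rw [eq_C_of_isEmpty p]
      exact hasSamePhase_C _
    · -- the step
      intro τ _ ih p r hhom hp
      exact hasSamePhase_step ih hhom hp
  exact key p r hhom hp

end Main

/-! ## §5 Real coefficients: one sign -/

section Real

/-- **The same-phase theorem for real stable forms**: a homogeneous real stable polynomial has all its coefficients
`≥ 0` or all `≤ 0` (the unit `u` of Thm. 6.1 is `±1` as soon as one coefficient is a nonzero real).
[cite: ChoeOxleySokalWagner2004, §6 Thm. 6.1] -/
theorem IsRealStable.coeff_nonneg_or_nonpos {σ : Type*} [Fintype σ] {f : MvPolynomial σ ℝ} {r : ℕ}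
    (hhom : f.IsHomogeneous r) (hf : IsRealStable f) : (∀ m, 0 ≤ coeff m f) ∨ (∀ m, coeff m f ≤ 0) := by
  classical
  by_cases hall : ∀ m, coeff m f = 0
  · exact Or.inl fun m => (hall m).ge
  push Not at hall
  obtain ⟨m₀, hm₀⟩ := hall
  obtain ⟨u, hu1, hu⟩ := IsUpperHalfPlaneStable.hasSamePhase (hhom.map (algebraMap ℝ ℂ)) hf
  have hcoe : ∀ m, coeff m (map (algebraMap ℝ ℂ) f) = ((coeff m f : ℝ) : ℂ) := fun m => by
    rw [coeff_map]
    rfl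
  have him : ∀ m, (u * ((coeff m f : ℝ) : ℂ)).im = u.im * coeff m f := fun m => by
    simp [Complex.mul_im]
  have hre : ∀ m, (u * ((coeff m f : ℝ) : ℂ)).re = u.re * coeff m f := fun m => by
    simp [Complex.mul_re]
  have him0 : u.im = 0 := by
    have h := (hu m₀).1
    rw [hcoe, him] at h
    exact (mul_eq_zero.1 h).resolve_right hm₀
  have hnn : ∀ m, 0 ≤ u.re * coeff m f := fun m => by
    have h := (hu m).2
    rwa [hcoe, hre] at h
  have hure : u.re ≠ 0 := by
    intro h
    have : u = 0 := Complex.ext h him0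
    rw [this, norm_zero] at hu1
    exact zero_ne_one hu1
  rcases lt_or_gt_of_ne hure with hneg | hpos
  · right
    intro m
    have := hnn m
    nlinarith
  · left
    intro m
    exact (mul_nonneg_iff_of_pos_left hpos).1 (hnn m)

end Real

end Literature.Combinatorics.StablePolynomials

end
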